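import Summits.NavierStokesRegularity.NavierStokesRegularity.Theorems.ExtremiserTransienceNearExtremalTransiencePerFlowStubZoneCalculus
import HarnessLib

/-!
# Crux `NearExtremalTransiencePerFlow` (stmt-NavierStokesRegularity-26567), LINE g7-β `zone_transversality`:
# the POROSITY form of the zone calculus (repair proposal for stub Z2 `stub_zoneLipschitz`)

`--supports stmt-NavierStokesRegularity-26567` (helper).  Pure real analysis, companion of the landed Z4
`stub_zoneCalculus` (`…StubZoneCalculus.lean`).

WHY.  The composition Z1 → Z2 → Z3 → Z4 of the line uses the zone-Lipschitz bound Z2 only to convert «no long sojourn in the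
zone `{k ≥ κs − ε}`» (Z1) into «every late log-window contains a log-interval of definite length on which `k ≤ κs − ε/2`»,
i.e. into uniform LOG-POROSITY of the near-extremal time set.  Z2 itself (a pointwise-in-time bound on `dk₀/d log-time` in
the zone) does not follow from the landed Type-I toolbox: `d log P/d log-time` contains the palinstrophy dissipation number
`ν(T−t)‖Δω‖₂²/P` and the pairing `‖∇²u‖_∞√(Z/P)` (the open upper lock), `d log N/d log-time` needs second-order Type-I and
pressure-gradient rates.  This file lands the statement the composition really needs from the dynamics, with the calculus
discharged:

* `mean_sq_le_of_window_deficit` — if a continuous `0 ≤ g ≤ κ` on `[0,∞)` loses a fixed amount `c > 0` of `∫ g²` on EVERY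
  window of length `W` (`∫_a^{a+W} g² ≤ κ²W − c`), then `∫_0^S g² ≤ (θ₀κ)²S + B` with `θ₀ = √(1 − c/(κ²W)) < 1`;
* `window_integral_le_of_gap` — a window `[a, a+W]` containing a log-interval of length `ρ` on which `g ≤ κ − ε` loses
  `c = (κ² − (κ−ε)²)ρ`;
* `logMean_le_of_porousZone` — **Z4\* (porosity calculus)**, in the time variable of the crux: if `k` is continuous on `[t₁,T)`,
  `0 ≤ k ≤ κs` there, and every late time `s ∈ [t₁,T)` is followed, within log-time `W`, by a closed interval of log-length `≥ ρ`
  on which `k ≤ κs − ε`, then `∫_{t₁}^t k²/(T−τ) ≤ (θ₀κs)²·log((T−t₁)/(T−t)) + B` on `[t₁,T)` with `θ₀ < 1`.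
With the landed Z3 (`stub_efficiencyContinuous`, continuity of `k₀`) the line closes from ONE dynamical statement
Z1\* «the near-extremal time set `{k₀ ≥ κ⋆ − ε}` of a violator flow is uniformly porous in log-time» (the honest heart; it is
implied by Z1 ∧ Z2 ∧ Z3 and does not ask for time-regularity of the efficiency).
HONEST FRAMING: real analysis of one real function; nothing about Navier–Stokes is proved here; no summit is proved by a line.
[folklore]
-/

noncomputable section

open Set MeasureTheory intervalIntegral

namespace Summit.NavierStokesRegularity.NavierStokesRegularity.Theorems.NearExtremalTransiencePerFlow.ZoneTransversality

-- the summit's namespace `Summit.NavierStokesRegularity.NavierStokesRegularity` repeats the problem name by convention (D-0017)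
set_option linter.dupNamespace false

/-! ### Window deficit ⇒ log-mean bound -/

/-- **Summation over windows.**  `g` continuous on `[0,∞)` with `0 ≤ g ≤ κ`; if `∫_a^{a+W} g² ≤ κ²W − c` for every `a ≥ 0`
(`0 < c ≤ κ²W`), then `∫_0^S g² ≤ (θ₀κ)²S + κ²W` for all `S ≥ 0` with `θ₀ = √(1 − c/(κ²W)) ∈ [0,1)`. [folklore] -/
theorem mean_sq_le_of_window_deficit {g : ℝ → ℝ} {κ W c : ℝ} (hκ : 0 < κ) (hW : 0 < W) (hc : 0 < c)
    (hcW : c ≤ κ ^ 2 * W) (hcont : ContinuousOn g (Ici 0)) (hg0 : ∀ σ : ℝ, 0 ≤ σ → 0 ≤ g σ)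
    (hgκ : ∀ σ : ℝ, 0 ≤ σ → g σ ≤ κ)
    (hwin : ∀ a : ℝ, 0 ≤ a → ∫ σ in a..(a + W), g σ ^ 2 ≤ κ ^ 2 * W - c) :
    ∃ θ₀ B : ℝ, 0 ≤ θ₀ ∧ θ₀ < 1 ∧ ∀ S : ℝ, 0 ≤ S → ∫ σ in 0..S, g σ ^ 2 ≤ (θ₀ * κ) ^ 2 * S + B := by
  have hκW : 0 < κ ^ 2 * W := by positivity
  have hratio0 : 0 < c / (κ ^ 2 * W) := div_pos hc hκW
  have hratio1 : c / (κ ^ 2 * W) ≤ 1 := (div_le_one hκW).2 hcW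
  refine ⟨Real.sqrt (1 - c / (κ ^ 2 * W)), κ ^ 2 * W, Real.sqrt_nonneg _, ?_, ?_⟩
  · rw [Real.sqrt_lt' one_pos, one_pow]
    linarith
  intro S hS
  have hθ : (Real.sqrt (1 - c / (κ ^ 2 * W)) * κ) ^ 2 = κ ^ 2 - c / W := by
    rw [mul_pow, Real.sq_sqrt (by linarith)]
    field_simp
  rw [hθ]
  obtain ⟨n, hn⟩ : ∃ n : ℕ, n = ⌊S / W⌋₊ := ⟨_, rfl⟩
  obtain ⟨S₀, hS₀⟩ : ∃ S₀ : ℝ, S₀ = S - n * W := ⟨_, rfl⟩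
  have hnle : (n : ℝ) * W ≤ S := by
    have := Nat.floor_le (div_nonneg hS hW.le)
    rw [← hn] at this
    rwa [le_div_iff₀ hW] at this
  have hnlt : S < (n + 1 : ℝ) * W := by
    have := Nat.lt_floor_add_one (S / W)
    rw [← hn] at this
    rwa [div_lt_iff₀ hW] at this
  have hS₀0 : 0 ≤ S₀ := by rw [hS₀]; linarith
  have hS₀W : S₀ < W := by rw [hS₀]; linarith
  have hSeq : S = S₀ + n * W := by rw [hS₀]; ring
  have key : ∀ m : ℕ, ∫ σ in 0..(S₀ + m * W), g σ ^ 2 ≤ κ ^ 2 * S₀ + m * (κ ^ 2 * W - c) := by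
    intro m
    induction m with
    | zero =>
      simp only [Nat.cast_zero, zero_mul, add_zero]
      have := integral_sq_le_of_bounds (g := g) (C := κ) hS₀0 (fun σ hσ => hg0 σ hσ.1)
        (fun σ hσ => hgκ σ hσ.1)
      simpa using this
    | succ m ih =>
      have hm0 : 0 ≤ S₀ + m * W := by positivity
      have i1 : IntervalIntegrable (fun σ => g σ ^ 2) volume 0 (S₀ + m * W) :=
        intervalIntegrable_sq_of_continuousOn hcont le_rfl hm0
      have i2 : IntervalIntegrable (fun σ => g σ ^ 2) volume (S₀ + m * W) (S₀ + m * W + W) :=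
        intervalIntegrable_sq_of_continuousOn hcont hm0 (by linarith)
      have hsplit : ∫ σ in 0..(S₀ + (m + 1 : ℕ) * W), g σ ^ 2 =
          (∫ σ in 0..(S₀ + m * W), g σ ^ 2) + ∫ σ in (S₀ + m * W)..(S₀ + m * W + W), g σ ^ 2 := by
        rw [intervalIntegral.integral_add_adjacent_intervals i1 i2]
        congr 1
        push_cast
        ring
      rw [hsplit]
      have hw := hwin (S₀ + m * W) hm0
      push_cast
      linarith
  have hfin := key n
  rw [← hSeq] at hfin
  have hcS₀ : c / W * S₀ ≤ c := by
    have : S₀ / W ≤ 1 := (div_le_one hW).2 hS₀W.le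
    calc c / W * S₀ = c * (S₀ / W) := by ring
      _ ≤ c * 1 := mul_le_mul_of_nonneg_left this hc.le
      _ = c := mul_one c
  have hexp : (κ ^ 2 - c / W) * S + κ ^ 2 * W =
      κ ^ 2 * S₀ + n * (κ ^ 2 * W - c) + (κ ^ 2 * W - c / W * S₀) := by
    rw [hSeq]
    field_simp
    ring
  rw [hexp]
  linarith

/-- **A gap costs a definite amount.**  If `[α, α + ρ] ⊂ [a, a + W]` and `g ≤ κ − ε` on `[α, α + ρ]` (`0 ≤ g ≤ κ` on `[0,∞)`,
`a ≥ 0`), then `∫_a^{a+W} g² ≤ κ²W − (κ² − (κ − ε)²)ρ`. [folklore] -/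
theorem window_integral_le_of_gap {g : ℝ → ℝ} {κ ε W ρ a α : ℝ}
    (hcont : ContinuousOn g (Ici 0)) (hg0 : ∀ σ : ℝ, 0 ≤ σ → 0 ≤ g σ) (hgκ : ∀ σ : ℝ, 0 ≤ σ → g σ ≤ κ)
    (ha : 0 ≤ a) (haα : a ≤ α) (hρ : 0 ≤ ρ) (hαW : α + ρ ≤ a + W) (hgap : ∀ σ ∈ Icc α (α + ρ), g σ ≤ κ - ε) :
    ∫ σ in a..(a + W), g σ ^ 2 ≤ κ ^ 2 * W - (κ ^ 2 - (κ - ε) ^ 2) * ρ := by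
  have hα0 : 0 ≤ α := ha.trans haα
  have i1 : IntervalIntegrable (fun σ => g σ ^ 2) volume a α := intervalIntegrable_sq_of_continuousOn hcont ha haα
  have i2 : IntervalIntegrable (fun σ => g σ ^ 2) volume α (α + ρ) :=
    intervalIntegrable_sq_of_continuousOn hcont hα0 (by linarith)
  have i3 : IntervalIntegrable (fun σ => g σ ^ 2) volume (α + ρ) (a + W) :=
    intervalIntegrable_sq_of_continuousOn hcont (by linarith) hαW
  have hsplit : ∫ σ in a..(a + W), g σ ^ 2 =
      (∫ σ in a..α, g σ ^ 2) + (∫ σ in α..(α + ρ), g σ ^ 2) + ∫ σ in (α + ρ)..(a + W), g σ ^ 2 := by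
    rw [intervalIntegral.integral_add_adjacent_intervals i1 i2,
      intervalIntegral.integral_add_adjacent_intervals (i1.trans i2) i3]
  have b1 : ∫ σ in a..α, g σ ^ 2 ≤ κ ^ 2 * (α - a) :=
    integral_sq_le_of_bounds haα (fun σ hσ => hg0 σ (ha.trans hσ.1)) (fun σ hσ => hgκ σ (ha.trans hσ.1))
  have b2 : ∫ σ in α..(α + ρ), g σ ^ 2 ≤ (κ - ε) ^ 2 * (α + ρ - α) :=
    integral_sq_le_of_bounds (by linarith) (fun σ hσ => hg0 σ (hα0.trans hσ.1)) hgap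
  have b3 : ∫ σ in (α + ρ)..(a + W), g σ ^ 2 ≤ κ ^ 2 * (a + W - (α + ρ)) :=
    integral_sq_le_of_bounds hαW (fun σ hσ => hg0 σ (by linarith [hσ.1])) (fun σ hσ => hgκ σ (by linarith [hσ.1]))
  rw [hsplit]
  nlinarith [b1, b2, b3]

/-! ### Z4\*: the porosity calculus in the time variable of the crux -/

/-- **Z4\* (porosity calculus).**  `k` continuous on `[t₁,T)` with `0 ≤ k` and `k ≤ κs` there (`0 < κs`, `0 < ε`,
`0 < ρ ≤ W`); POROSITY of the near-extremal set: for every `s ∈ [t₁,T)` there is a closed interval `[a,b] ⊂ [s,T)` with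
`log((T−s)/(T−b)) ≤ W`, `log((T−a)/(T−b)) ≥ ρ` and `k ≤ κs − ε` on `[a,b]`.  Then for some `θ₀ ∈ [0,1)` and `B`:
`∫_{t₁}^t k²/(T−τ) dτ ≤ (θ₀κs)²·log((T−t₁)/(T−t)) + B` on `[t₁,T)`. [folklore] -/
theorem logMean_le_of_porousZone :
    ∀ (k : ℝ → ℝ) (T t₁ κs ε ρ W : ℝ), 0 < κs → 0 < ε → 0 < ρ → ρ ≤ W → t₁ < T →
    (∀ τ, 0 ≤ k τ) → (∀ τ ∈ Set.Ico t₁ T, k τ ≤ κs) → ContinuousOn k (Set.Ico t₁ T) →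
    (∀ s ∈ Set.Ico t₁ T, ∃ a b : ℝ, s ≤ a ∧ a ≤ b ∧ b < T ∧ Real.log ((T - s) / (T - b)) ≤ W ∧
      ρ ≤ Real.log ((T - a) / (T - b)) ∧ ∀ τ ∈ Set.Icc a b, k τ ≤ κs - ε) →
    ∃ θ₀ B : ℝ, 0 ≤ θ₀ ∧ θ₀ < 1 ∧ ∀ t ∈ Set.Ico t₁ T,
      ∫ τ in t₁..t, k τ ^ 2 / (T - τ) ≤ (θ₀ * κs) ^ 2 * Real.log ((T - t₁) / (T - t)) + B := by
  intro k T t₁ κs ε ρ W hκs hε hρ hρW ht₁T hk0 hkκ hcont hpor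
  have hTt₁ : 0 < T - t₁ := sub_pos.2 ht₁T
  have hW : 0 < W := hρ.trans_le hρW
  -- log-time parametrisation (as in `stub_zoneCalculus`)
  obtain ⟨φ, hφ⟩ : ∃ φ : ℝ → ℝ, φ = fun σ => T - (T - t₁) * Real.exp (-σ) := ⟨_, rfl⟩
  have hTφ : ∀ σ, T - φ σ = (T - t₁) * Real.exp (-σ) := fun σ => by rw [hφ]; ring
  have hφT : ∀ σ, φ σ < T := fun σ => by
    have : 0 < (T - t₁) * Real.exp (-σ) := by positivity
    linarith [hTφ σ]
  have hφt₁ : ∀ σ, 0 ≤ σ → t₁ ≤ φ σ := fun σ hσ => by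
    have h1 : Real.exp (-σ) ≤ 1 := Real.exp_le_one_iff.2 (by linarith)
    have h2 : (T - t₁) * Real.exp (-σ) ≤ (T - t₁) * 1 := mul_le_mul_of_nonneg_left h1 hTt₁.le
    linarith [hTφ σ]
  have hφcont : Continuous φ := by rw [hφ]; fun_prop
  have hφderiv : ∀ σ, HasDerivAt φ ((T - t₁) * Real.exp (-σ)) σ := fun σ => by
    rw [hφ]
    exact (((hasDerivAt_neg σ).exp.const_mul (T - t₁)).const_sub T).congr_deriv (by ring)
  -- the inverse parametrisation `ψ τ = log((T−t₁)/(T−τ))`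
  obtain ⟨ψ, hψ⟩ : ∃ ψ : ℝ → ℝ, ψ = fun τ => Real.log ((T - t₁) / (T - τ)) := ⟨_, rfl⟩
  have hφψ : ∀ τ, τ < T → φ (ψ τ) = τ := fun τ hτ => by
    have hTτ : 0 < T - τ := sub_pos.2 hτ
    rw [hφ, hψ]
    simp only
    rw [Real.exp_neg, Real.exp_log (div_pos hTt₁ hTτ), inv_div]
    field_simp
    ring
  have hψφ : ∀ σ, ψ (φ σ) = σ := fun σ => by
    rw [hψ]
    simp only
    rw [hTφ σ, ← div_div, div_self hTt₁.ne', one_div, Real.exp_neg, inv_inv, Real.log_exp]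
  have hψmono : ∀ τ τ', τ ≤ τ' → τ' < T → ψ τ ≤ ψ τ' := fun τ τ' hle hlt => by
    have hTτ' : 0 < T - τ' := sub_pos.2 hlt
    have hTτ : 0 < T - τ := by linarith
    rw [hψ]
    exact Real.log_le_log (div_pos hTt₁ hTτ) (div_le_div_of_nonneg_left hTt₁.le hTτ' (by linarith))
  have hψdiff : ∀ τ τ', τ < T → τ' < T → ψ τ' - ψ τ = Real.log ((T - τ) / (T - τ')) := fun τ τ' hτ hτ' => by
    have hTτ' : 0 < T - τ' := sub_pos.2 hτ'
    have hTτ : 0 < T - τ := sub_pos.2 hτ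
    rw [hψ]
    simp only
    rw [← Real.log_div (div_pos hTt₁ hTτ').ne' (div_pos hTt₁ hTτ).ne', div_div_div_cancel_left' _ _ hTt₁.ne']
  -- the log-time function and its window deficit
  obtain ⟨g, hg⟩ : ∃ g : ℝ → ℝ, g = fun σ => k (φ σ) := ⟨_, rfl⟩
  obtain ⟨ε', hε'⟩ : ∃ ε' : ℝ, ε' = min ε κs := ⟨_, rfl⟩
  have hε'0 : 0 < ε' := by rw [hε']; exact lt_min hε hκs
  have hε'κ : ε' ≤ κs := by rw [hε']; exact min_le_right _ _
  have hε'ε : ε' ≤ ε := by rw [hε']; exact min_le_left _ _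
  have hgcont : ContinuousOn g (Ici 0) := by
    rw [hg]
    exact hcont.comp hφcont.continuousOn fun σ hσ => ⟨hφt₁ σ hσ, hφT σ⟩
  have hg0' : ∀ σ : ℝ, 0 ≤ σ → 0 ≤ g σ := fun σ _ => by rw [hg]; exact hk0 _
  have hgκ' : ∀ σ : ℝ, 0 ≤ σ → g σ ≤ κs := fun σ hσ => by
    rw [hg]; exact hkκ _ ⟨hφt₁ σ hσ, hφT σ⟩
  obtain ⟨c, hc⟩ : ∃ c : ℝ, c = (κs ^ 2 - (κs - ε') ^ 2) * ρ := ⟨_, rfl⟩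
  have hc0 : 0 < c := by
    rw [hc]
    have : 0 < κs ^ 2 - (κs - ε') ^ 2 := by nlinarith
    positivity
  have hcW : c ≤ κs ^ 2 * W := by
    rw [hc]
    have h1 : κs ^ 2 - (κs - ε') ^ 2 ≤ κs ^ 2 := by nlinarith [sq_nonneg (κs - ε')]
    calc (κs ^ 2 - (κs - ε') ^ 2) * ρ ≤ κs ^ 2 * ρ := mul_le_mul_of_nonneg_right h1 hρ.le
      _ ≤ κs ^ 2 * W := mul_le_mul_of_nonneg_left hρW (sq_nonneg _)
  have hwin : ∀ A : ℝ, 0 ≤ A → ∫ σ in A..(A + W), g σ ^ 2 ≤ κs ^ 2 * W - c := by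
    intro A hA
    obtain ⟨a, b, hsa, hab, hbT, hWb, hρab, hgap⟩ := hpor (φ A) ⟨hφt₁ A hA, hφT A⟩
    have haT : a < T := lt_of_le_of_lt hab hbT
    -- the gap `[ψ a, ψ a + ρ] ⊂ [A, A + W]`
    have hAα : A ≤ ψ a := by rw [← hψφ A]; exact hψmono _ _ hsa haT
    have hαβ : ρ ≤ ψ b - ψ a := by rw [hψdiff a b haT hbT]; exact hρab
    have hβW : ψ b ≤ A + W := by
      have h := hψdiff (φ A) b (hφT A) hbT
      rw [hψφ A] at h
      linarith
    rw [hc]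
    refine window_integral_le_of_gap hgcont hg0' hgκ' hA hAα hρ.le (by linarith) fun σ hσ => ?_
    -- `φ σ ∈ [a, b]`
    have hσb : σ ≤ ψ b := by linarith [hσ.2]
    have h1 : a ≤ φ σ := by
      have := hφψ a haT
      rw [hφ] at this ⊢
      simp only at this ⊢
      have he : Real.exp (-σ) ≤ Real.exp (-ψ a) := Real.exp_le_exp.2 (by linarith [hσ.1])
      have := mul_le_mul_of_nonneg_left he hTt₁.le
      linarith
    have h2 : φ σ ≤ b := by
      have := hφψ b hbT
      rw [hφ] at this ⊢
      simp only at this ⊢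
      have he : Real.exp (-ψ b) ≤ Real.exp (-σ) := Real.exp_le_exp.2 (by linarith)
      have := mul_le_mul_of_nonneg_left he hTt₁.le
      linarith
    have := hgap (φ σ) ⟨h1, h2⟩
    rw [hg]
    simp only
    linarith
  obtain ⟨θ₀, B, hθ0, hθ1, hcore⟩ := mean_sq_le_of_window_deficit hκs hW hc0 hcW hgcont hg0' hgκ' hwin
  refine ⟨θ₀, B, hθ0, hθ1, fun t ht => ?_⟩
  -- change of variables `τ = φ σ` on `[0, S]`, `S = log((T−t₁)/(T−t))`
  have hTt : 0 < T - t := sub_pos.2 ht.2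
  have hpos : 0 < (T - t₁) / (T - t) := div_pos hTt₁ hTt
  obtain ⟨S, hSdef⟩ : ∃ S : ℝ, S = Real.log ((T - t₁) / (T - t)) := ⟨_, rfl⟩
  have hS0 : 0 ≤ S := by
    rw [hSdef]
    exact Real.log_nonneg ((one_le_div hTt).2 (by linarith [ht.1]))
  have hφ0 : φ 0 = t₁ := by rw [hφ]; simp
  have hφS : φ S = t := by
    rw [hφ, hSdef]
    simp only
    rw [Real.exp_neg, Real.exp_log hpos, inv_div]
    field_simp
    ring
  have hsub : ∫ τ in t₁..t, k τ ^ 2 / (T - τ) = ∫ σ in 0..S, g σ ^ 2 := by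
    have h := intervalIntegral.integral_comp_mul_deriv_of_deriv_nonneg (a := 0) (b := S) (f := φ)
      (f' := fun σ => (T - t₁) * Real.exp (-σ)) (g := fun τ => k τ ^ 2 / (T - τ))
      hφcont.continuousOn (fun x _ => hφderiv x) (fun x _ => by positivity)
    rw [hφ0, hφS] at h
    rw [← h]
    refine intervalIntegral.integral_congr fun σ _ => ?_
    have hne : (T - t₁) * Real.exp (-σ) ≠ 0 := by positivity
    simp only [Function.comp_apply]
    rw [hTφ σ, hg]
    field_simp
  rw [hsub, ← hSdef]
  exact hcore S hS0

end Summit.NavierStokesRegularity.NavierStokesRegularity.Theorems.NearExtremalTransiencePerFlow.ZoneTransversality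

end
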